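import Summits.QuantumFields.GaugeBoot.Certificates.SparseReducedWindow
import Summits.QuantumFields.GaugeBoot.Certificates.KZL2HD4EntA
import Summits.QuantumFields.GaugeBoot.Certificates.KZL2HD4EntB
import Summits.QuantumFields.GaugeBoot.Certificates.KZL2HD4EntC
import Summits.QuantumFields.GaugeBoot.Certificates.KZL2HD4EntD
import Summits.QuantumFields.GaugeBoot.Certificates.KZL2HD4EntE
import Summits.QuantumFields.GaugeBoot.Certificates.KZL2HD4EntF
import Summits.QuantumFields.GaugeBoot.Certificates.KZL2HD4EntG
import Summits.QuantumFields.GaugeBoot.Certificates.KZL2HD4EntH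
import Summits.QuantumFields.GaugeBoot.Certificates.KZL2HD4EntI
import Summits.QuantumFields.GaugeBoot.Certificates.KZL2HD4EntJ
import Summits.QuantumFields.GaugeBoot.Certificates.KZL2HD4EntK
import Summits.QuantumFields.GaugeBoot.Certificates.KZL2HD4EntL
import Summits.QuantumFields.GaugeBoot.Certificates.KZL2HD4EntM
import Summits.QuantumFields.GaugeBoot.Certificates.KZL2HD4EntN
import Summits.QuantumFields.GaugeBoot.Certificates.KZL2HD4EntO
import Summits.QuantumFields.GaugeBoot.Certificates.KZL2HD4EntP
import HarnessLib

/-!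
# Kernel checks of the reduced problem family `KZL2HD4`, part A: tables, dimension and row-length checks (gb_lean_emit_win 0.10)

HONEST FRAMING (cell `pub-gaugeboot`): certified bounds on lattice expectations at stated coupling,
gauge group, dimension and torus size; NOT a mass gap, NOT a continuum limit, NOT a string tension;
NOT Yang–Mills-summit-bearing (barriers `FixedCouplingUltralocality`, `PerturbativeInvisibility`).
Family `KZL2HD4` (2306 variables, 30 reduced blocks of dimensions `dimL`, max 30; signature sha256
`e00fafe4caba89145c77c71e7e721b914a808131ca3b0d1762729b1a4ed325d2`): WINDOW ROUTE (emitter 0.10, support `Certificates/SparseReducedWindow.lean`) — this module assembles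
the entry tables `EB` from the data parts and runs the two β-independent kernel checks `dimCheck` (entries outside a block's
own dimension are empty) and `rowLenCheck` (stored row `i` has ≤ `m − i` entries, so the raw-recursor sweep agrees with the
counted one). The binding interface `dim`/`ent`/`redBlock`/`redBlock_apply` is in `Certificates/KZL2HD4Tab.lean`.
Nothing is claimed about lattice gauge theory in this file.
-/

namespace Summit.QuantumFields.GaugeBoot.Certificates.KZL2HD4

noncomputable section

open Matrix Summit.QuantumFields.GaugeBoot.Certificates.Sparse

/-- The upper-triangular entry tables of all blocks (data parts assembled in block order). -/
def EB : List (List (List (List (ℕ × ℤ)))) := EBa0 ++ [EBb0 ++ EBc0] ++ EBd0 ++ EBe0 ++ EBf0 ++ EBg0 ++ [EBg1 ++ EBh0] ++ EBh1 ++ EBi0 ++ [EBi1 ++ EBj0 ++ EBk0] ++ [EBk1 ++ EBl0] ++ [EBl1 ++ EBm0] ++ EBm1 ++ EBn0 ++ [EBn1 ++ EBo0 ++ EBp0] ++ EBp1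

set_option maxHeartbeats 0 in
/-- Kernel check: entries outside each block's own dimension are empty (padding to 30×30). -/
theorem dim_chk : dimCheck EB dimL 30 30 = true := by
  decide +kernel

set_option maxHeartbeats 0 in
/-- Kernel check: stored row `i` of every block has at most `30 − i` entries. -/
theorem row_len : rowLenCheck EB 30 30 = true := by
  decide +kernel

end

end Summit.QuantumFields.GaugeBoot.Certificates.KZL2HD4
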